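import Summits.ValiantsHypothesis.ValiantsHypothesis.Theorems.KPlusLogSqLawTridiagonalRealStaticPotentialSteps

/-!
# Route «KPlusLogSqLaw», crux `WeakLifting` (stmt-ValiantsHypothesis-19561) — REAL side of the tridiagonal sector:
# the UNIT-COEFFICIENT sub-sector of the α register — LOWER ROWS `U 6 ≥ 3`, `U 7 ≥ 4`

HONEST FRAMING.  Helper theorems (`--supports stmt-ValiantsHypothesis-19561 --as helper`), seat val-sym-lift-p1 (g15), cell `pub-symmetroid`,
2026-08-28; companion of `…TridiagonalRealStaticUnitSmall` (resonance law, `U 3 = 1`, `U 4 = 2`) and `…UnitShadow` (`U 5 ≥ 3`, p601719).  The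
unit-coefficient sub-sector of the α register (static definite symmetric tridiagonal monomial designs, continuant currency
`StaticTridiagonalRealPotential.pathDet a d b f m` with `a ≡ b ≡ 1`); `U m` = the largest number of distinct positive determinant zeros there.
Two explicit designs with rational sign certificates:
* `exists_unit_six_three_le_card`: diagonal `(1,…,1)`, links `(X,…,X)` at size `6` — determinant `1 − 5X² + 6X⁴ − X⁶` (the matching polynomial of the path
  `P₆` at `−X²`), signs `+ − + −` at `1/2, 7/10, 1, 3` ⇒ **`U 6 ≥ 3`**;
* `exists_unit_seven_four_le_card`: diagonal `(X³, 1, X², X, 1, X, 1)`, links `(1, 1, 1, X, X, X)` at size `7` (edge slopes `L = (−3,−2,−3,1,1,1)`, a maximiser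
  of the seat's exact census over `L ∈ [−3,3]⁶`) — determinant `X − 2X² − 2X⁴ + 4X⁵ + 2X⁶ − 3X⁸ + X⁹`, signs `+ − + − +` at `1/2, 3/5, 1, 2, 3` ⇒ **`U 7 ≥ 4`**,
  one more than the `⌊7/2⌋ = 3` of every one-signed design of size `7` (mixed slopes are needed for the odd-size surplus).
LOCATED (seat memo UNIT-SUBSECTOR-liftp1g15.md; exact Sturm censuses, every slope vector of the box): `U 5 = 3` on `[−4,4]⁴`, `U 6 = 3` on `[−3,3]⁵`,
`U 7 = 4` on `[−3,3]⁶`; conjecture `U m = ⌈m/2⌉` (`m ≥ 4`).  Equality at `m = 6, 7` is NOT claimed here.  Nothing here is an upper law; nothing bears on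
`WeakLifting` / `TropicalB` (stmt-19771) in their windows, Conjecture B, the Door-A registers, `MatrixDescartes` (stmt-18050) or VP ≠ VNP.
[this seat; folklore: continuants ↔ matchings of the path, IVT sign certificates]
-/

-- `Summit.ValiantsHypothesis.ValiantsHypothesis.…` repeats a component by the D-0017 layout (single-conjunct summit); the name is mandated.
set_option linter.dupNamespace false
set_option autoImplicit false

namespace Summit.ValiantsHypothesis.ValiantsHypothesis.Theorems.KPlusLogSqLaw
namespace StaticTridiagonalRealUnit

open Polynomial Finset
open Summit.ValiantsHypothesis.ValiantsHypothesis.Theorems.KPlusLogSqLaw.StaticTridiagonalRealPotential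
  (pathDet pathDet_zero pathDet_one pathDet_add_two)
open Summit.ValiantsHypothesis.ValiantsHypothesis.Theorems.SymmetroidDescartes (le_card_posRoots_of_alternating)

/-- evaluation form of the unit recurrence: `D_{n+2}(x) = x^{d_{n+1}} D_{n+1}(x) − x^{2f_n} D_n(x)`. [folklore: continuants] -/
theorem eval_unit_add_two (d f : ℕ → ℕ) (x : ℝ) (n : ℕ) :
    (pathDet (fun _ => (1 : ℝ)) d (fun _ => (1 : ℝ)) f (n + 2)).eval x =
      x ^ d (n + 1) * (pathDet (fun _ => (1 : ℝ)) d (fun _ => (1 : ℝ)) f (n + 1)).eval x -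
        x ^ (2 * f n) * (pathDet (fun _ => (1 : ℝ)) d (fun _ => (1 : ℝ)) f n).eval x := by
  rw [pathDet_add_two]
  simp only [eval_sub, eval_mul, eval_pow, eval_C, eval_X, one_mul]
  ring

/-- `D₀(x) = 1`, `D₁(x) = x^{d₀}` for a unit design. -/
theorem eval_unit_zero_one (d f : ℕ → ℕ) (x : ℝ) :
    (pathDet (fun _ => (1 : ℝ)) d (fun _ => (1 : ℝ)) f 0).eval x = 1 ∧
      (pathDet (fun _ => (1 : ℝ)) d (fun _ => (1 : ℝ)) f 1).eval x = x ^ d 0 := by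
  rw [pathDet_zero, pathDet_one]
  simp

/-- the equal-slope unit design of size `6` (diagonal `1`, links `X`): `D₆ = 1 − 5X² + 6X⁴ − X⁶`. -/
theorem eval_unit_six_equal (x : ℝ) :
    (pathDet (fun _ => (1 : ℝ)) (fun _ => 0) (fun _ => (1 : ℝ)) (fun _ => 1) 6).eval x = 1 - 5 * x ^ 2 + 6 * x ^ 4 - x ^ 6 := by
  obtain ⟨e0, e1⟩ := eval_unit_zero_one (fun _ => 0) (fun _ => 1) x
  have e2 := eval_unit_add_two (fun _ => 0) (fun _ => 1) x 0
  have e3 := eval_unit_add_two (fun _ => 0) (fun _ => 1) x 1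
  have e4 := eval_unit_add_two (fun _ => 0) (fun _ => 1) x 2
  have e5 := eval_unit_add_two (fun _ => 0) (fun _ => 1) x 3
  have e6 := eval_unit_add_two (fun _ => 0) (fun _ => 1) x 4
  simp only [zero_add] at e2
  rw [e6, e5, e4, e3, e2, e1, e0]
  ring

/-- **`U 6 ≥ 3`**: the equal-slope unit design of size `6` has at least three distinct positive determinant zeros (signs `+ − + −` at
`1/2, 7/10, 1, 3`; the zeros are `x² = 1/(4cos²(jπ/7))`, `j = 1, 2, 3`). [this file] -/
theorem exists_unit_six_three_le_card :
    ∃ d f : ℕ → ℕ, 3 ≤ ((pathDet (fun _ => (1 : ℝ)) d (fun _ => (1 : ℝ)) f 6).roots.toFinset.filter (fun x => 0 < x)).card := by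
  refine ⟨fun _ => 0, fun _ => 1, le_card_posRoots_of_alternating _ 3 (![1 / 2, 7 / 10, 1, 3] : Fin 4 → ℝ) ?_ ?_ ?_⟩
  · refine Fin.strictMono_iff_lt_succ.2 fun j => ?_
    fin_cases j <;> norm_num [Matrix.cons_val_two, Matrix.tail_cons, Matrix.head_cons]
  · intro j; fin_cases j <;> norm_num [Matrix.cons_val_two, Matrix.tail_cons, Matrix.head_cons]
  · intro j; fin_cases j <;> norm_num [Matrix.cons_val_two, Matrix.tail_cons, Matrix.head_cons, eval_unit_six_equal]

/-- the size-`7` census maximiser (diagonal `(X³, 1, X², X, 1, X, 1)`, links `(1, 1, 1, X, X, X)`):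
`D₇ = X − 2X² − 2X⁴ + 4X⁵ + 2X⁶ − 3X⁸ + X⁹`. -/
theorem eval_unit_seven_max (x : ℝ) :
    (pathDet (fun _ => (1 : ℝ))
        (fun t => if t = 0 then 3 else if t = 2 then 2 else if t = 3 then 1 else if t = 5 then 1 else 0)
        (fun _ => (1 : ℝ)) (fun t => if t ≤ 2 then 0 else 1) 7).eval x =
      x - 2 * x ^ 2 - 2 * x ^ 4 + 4 * x ^ 5 + 2 * x ^ 6 - 3 * x ^ 8 + x ^ 9 := by
  obtain ⟨e0, e1⟩ := eval_unit_zero_one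
    (fun t => if t = 0 then 3 else if t = 2 then 2 else if t = 3 then 1 else if t = 5 then 1 else 0)
    (fun t => if t ≤ 2 then 0 else 1) x
  have e := fun n => eval_unit_add_two
    (fun t => if t = 0 then 3 else if t = 2 then 2 else if t = 3 then 1 else if t = 5 then 1 else 0)
    (fun t => if t ≤ 2 then 0 else 1) x n
  have e2 := e 0
  have e3 := e 1
  have e4 := e 2
  have e5 := e 3
  have e6 := e 4
  have e7 := e 5
  simp only [zero_add] at e2
  rw [e7, e6, e5, e4, e3, e2, e1, e0]
  norm_num
  ring

/-- **`U 7 ≥ 4`**: the size-`7` maximiser has at least four distinct positive determinant zeros (signs `+ − + − +` at `1/2, 3/5, 1, 2, 3`) —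
one more than every one-signed unit design of size `7` (`⌊7/2⌋ = 3`, `…MonotonePencilInertia`). [this file] -/
theorem exists_unit_seven_four_le_card :
    ∃ d f : ℕ → ℕ, 4 ≤ ((pathDet (fun _ => (1 : ℝ)) d (fun _ => (1 : ℝ)) f 7).roots.toFinset.filter (fun x => 0 < x)).card := by
  refine ⟨fun t => if t = 0 then 3 else if t = 2 then 2 else if t = 3 then 1 else if t = 5 then 1 else 0,
    fun t => if t ≤ 2 then 0 else 1, le_card_posRoots_of_alternating _ 4 (![1 / 2, 3 / 5, 1, 2, 3] : Fin 5 → ℝ) ?_ ?_ ?_⟩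
  · refine Fin.strictMono_iff_lt_succ.2 fun j => ?_
    fin_cases j <;> norm_num [Matrix.cons_val_two, Matrix.tail_cons, Matrix.head_cons]
  · intro j; fin_cases j <;> norm_num [Matrix.cons_val_two, Matrix.tail_cons, Matrix.head_cons]
  · intro j; fin_cases j <;> norm_num [Matrix.cons_val_two, Matrix.tail_cons, Matrix.head_cons, eval_unit_seven_max]

/-! ### Appendix (same seat, same day): the rows `U 8 ≥ 4` and `U 9 ≥ 5`

The equal-slope unit design of size `8` (diagonal `1`, links `X`) has determinant `1 − 7X² + 15X⁴ − 10X⁶ + X⁸` with four positive zeros (one of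
them the resonance `x = 1`, `8 ≡ 2 (mod 3)`), and the lopsided size-`9` unit design with edge slopes `L = (−3,−3,−2,9,12,−1,−1,−1)` (diagonal
`(X³,1,X³,X,1,1,X,1,X)`, links `(1,1,X,X⁵,X⁶,1,1,1)`; found by the seat's lopsided random probe, tools/lopsided.py) has FIVE — again one more than
the `⌊9/2⌋ = 4` of every one-signed design of size `9`.  Located (not claimed): `U 8 = 4`, `U 9 = 5`. -/

/-- the equal-slope unit design of size `8`: `D₈ = 1 − 7X² + 15X⁴ − 10X⁶ + X⁸`. -/
theorem eval_unit_eight_equal (x : ℝ) :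
    (pathDet (fun _ => (1 : ℝ)) (fun _ => 0) (fun _ => (1 : ℝ)) (fun _ => 1) 8).eval x =
      1 - 7 * x ^ 2 + 15 * x ^ 4 - 10 * x ^ 6 + x ^ 8 := by
  obtain ⟨e0, e1⟩ := eval_unit_zero_one (fun _ => 0) (fun _ => 1) x
  have e := fun n => eval_unit_add_two (fun _ => 0) (fun _ => 1) x n
  have e2 := e 0
  have e3 := e 1
  have e4 := e 2
  have e5 := e 3
  have e6 := e 4
  have e7 := e 5
  have e8 := e 6
  simp only [zero_add] at e2
  rw [e8, e7, e6, e5, e4, e3, e2, e1, e0]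
  ring

/-- **`U 8 ≥ 4`**: the equal-slope unit design of size `8` has at least four distinct positive determinant zeros (signs `+ − + − +` at
`1/2, 3/5, 4/5, 6/5, 3`). [this file] -/
theorem exists_unit_eight_four_le_card :
    ∃ d f : ℕ → ℕ, 4 ≤ ((pathDet (fun _ => (1 : ℝ)) d (fun _ => (1 : ℝ)) f 8).roots.toFinset.filter (fun x => 0 < x)).card := by
  refine ⟨fun _ => 0, fun _ => 1, le_card_posRoots_of_alternating _ 4 (![1 / 2, 3 / 5, 4 / 5, 6 / 5, 3] : Fin 5 → ℝ) ?_ ?_ ?_⟩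
  · refine Fin.strictMono_iff_lt_succ.2 fun j => ?_
    fin_cases j <;> norm_num [Matrix.cons_val_two, Matrix.tail_cons, Matrix.head_cons]
  · intro j; fin_cases j <;> norm_num [Matrix.cons_val_two, Matrix.tail_cons, Matrix.head_cons]
  · intro j; fin_cases j <;> norm_num [Matrix.cons_val_two, Matrix.tail_cons, Matrix.head_cons, eval_unit_eight_equal]

/-- the lopsided size-`9` design (diagonal `(X³,1,X³,X,1,1,X,1,X)`, links `(1,1,X,X⁵,X⁶,1,1,1)`):
`D₉ = X² − 3X³ − X⁴ + 5X⁵ + X⁶ − 3X⁸ + X⁹ + 2X¹³ − 6X¹⁴ + 4X¹⁵ − 2X¹⁶ − X¹⁷ − X¹⁸ + X¹⁹ + 2X²⁰ − X²¹`. -/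
theorem eval_unit_nine_lopsided (x : ℝ) :
    (pathDet (fun _ => (1 : ℝ))
        (fun t => if t = 0 then 3 else if t = 2 then 3 else if t = 3 then 1 else if t = 6 then 1 else if t = 8 then 1 else 0)
        (fun _ => (1 : ℝ)) (fun t => if t = 2 then 1 else if t = 3 then 5 else if t = 4 then 6 else 0) 9).eval x =
      x ^ 2 - 3 * x ^ 3 - x ^ 4 + 5 * x ^ 5 + x ^ 6 - 3 * x ^ 8 + x ^ 9 + 2 * x ^ 13 - 6 * x ^ 14 + 4 * x ^ 15 -
        2 * x ^ 16 - x ^ 17 - x ^ 18 + x ^ 19 + 2 * x ^ 20 - x ^ 21 := by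
  obtain ⟨e0, e1⟩ := eval_unit_zero_one
    (fun t => if t = 0 then 3 else if t = 2 then 3 else if t = 3 then 1 else if t = 6 then 1 else if t = 8 then 1 else 0)
    (fun t => if t = 2 then 1 else if t = 3 then 5 else if t = 4 then 6 else 0) x
  have e := fun n => eval_unit_add_two
    (fun t => if t = 0 then 3 else if t = 2 then 3 else if t = 3 then 1 else if t = 6 then 1 else if t = 8 then 1 else 0)
    (fun t => if t = 2 then 1 else if t = 3 then 5 else if t = 4 then 6 else 0) x n
  have e2 := e 0
  have e3 := e 1
  have e4 := e 2
  have e5 := e 3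
  have e6 := e 4
  have e7 := e 5
  have e8 := e 6
  have e9 := e 7
  simp only [zero_add] at e2
  rw [e9, e8, e7, e6, e5, e4, e3, e2, e1, e0]
  norm_num
  ring

/-- **`U 9 ≥ 5`**: the lopsided size-`9` design has at least five distinct positive determinant zeros (signs `+ − + − + −` at
`3/10, 1/2, 4/5, 1, 2, 3`; three of them below `x = 1`) — one more than every one-signed unit design of size `9` (`⌊9/2⌋ = 4`). [this file] -/
theorem exists_unit_nine_five_le_card :
    ∃ d f : ℕ → ℕ, 5 ≤ ((pathDet (fun _ => (1 : ℝ)) d (fun _ => (1 : ℝ)) f 9).roots.toFinset.filter (fun x => 0 < x)).card := by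
  refine ⟨fun t => if t = 0 then 3 else if t = 2 then 3 else if t = 3 then 1 else if t = 6 then 1 else if t = 8 then 1 else 0,
    fun t => if t = 2 then 1 else if t = 3 then 5 else if t = 4 then 6 else 0,
    le_card_posRoots_of_alternating _ 5 (![3 / 10, 1 / 2, 4 / 5, 1, 2, 3] : Fin 6 → ℝ) ?_ ?_ ?_⟩
  · refine Fin.strictMono_iff_lt_succ.2 fun j => ?_
    fin_cases j <;> norm_num [Matrix.cons_val_two, Matrix.tail_cons, Matrix.head_cons]
  · intro j; fin_cases j <;> norm_num [Matrix.cons_val_two, Matrix.tail_cons, Matrix.head_cons]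
  · intro j; fin_cases j <;> norm_num [Matrix.cons_val_two, Matrix.tail_cons, Matrix.head_cons, eval_unit_nine_lopsided]

/-! ### Appendix 2 (same seat, same day): the rows `U 10 ≥ 5` and `U 11 ≥ 6`

The equal-slope unit design of size `10` has determinant `1 − 9X² + 28X⁴ − 35X⁶ + 15X⁸ − X¹⁰` (matching polynomial of `P₁₀` at `−X²`) with five
positive zeros, and the lopsided size-`11` unit design with edge slopes `L = (9,−12,−2,1,2,−4,−9,12,6,1)` (diagonal exponents
`(1,0,12,0,1,1,3,6,0,0,1)`, link exponents `(5,0,5,1,2,0,0,9,3,1)`; tools/lopsided.py, seed 21) has SIX (three below `x = 1`, the resonance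
`x = 1`, two above) — again `⌊11/2⌋ + 1`.  Located (not claimed): `U 10 = 5`, `U 11 = 6`. -/

/-- the equal-slope unit design of size `10`: `D₁₀ = 1 − 9X² + 28X⁴ − 35X⁶ + 15X⁸ − X¹⁰`. -/
theorem eval_unit_ten_equal (x : ℝ) :
    (pathDet (fun _ => (1 : ℝ)) (fun _ => 0) (fun _ => (1 : ℝ)) (fun _ => 1) 10).eval x =
      1 - 9 * x ^ 2 + 28 * x ^ 4 - 35 * x ^ 6 + 15 * x ^ 8 - x ^ 10 := by
  obtain ⟨e0, e1⟩ := eval_unit_zero_one (fun _ => 0) (fun _ => 1) x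
  have e := fun n => eval_unit_add_two (fun _ => 0) (fun _ => 1) x n
  have e2 := e 0
  have e3 := e 1
  have e4 := e 2
  have e5 := e 3
  have e6 := e 4
  have e7 := e 5
  have e8 := e 6
  have e9 := e 7
  have e10 := e 8
  simp only [zero_add] at e2
  rw [e10, e9, e8, e7, e6, e5, e4, e3, e2, e1, e0]
  ring

/-- **`U 10 ≥ 5`**: the equal-slope unit design of size `10` has at least five distinct positive determinant zeros (signs `+ − + − + −` at
`1/2, 11/20, 3/5, 9/10, 3/2, 4`). [this file] -/
theorem exists_unit_ten_five_le_card :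
    ∃ d f : ℕ → ℕ, 5 ≤ ((pathDet (fun _ => (1 : ℝ)) d (fun _ => (1 : ℝ)) f 10).roots.toFinset.filter (fun x => 0 < x)).card := by
  refine ⟨fun _ => 0, fun _ => 1, le_card_posRoots_of_alternating _ 5 (![1 / 2, 11 / 20, 3 / 5, 9 / 10, 3 / 2, 4] : Fin 6 → ℝ) ?_ ?_ ?_⟩
  · refine Fin.strictMono_iff_lt_succ.2 fun j => ?_
    fin_cases j <;> norm_num [Matrix.cons_val_two, Matrix.tail_cons, Matrix.head_cons]
  · intro j; fin_cases j <;> norm_num [Matrix.cons_val_two, Matrix.tail_cons, Matrix.head_cons]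
  · intro j; fin_cases j <;> norm_num [Matrix.cons_val_two, Matrix.tail_cons, Matrix.head_cons, eval_unit_ten_equal]

/-- the lopsided size-`11` design: `D₁₁ = X⁴ − 2X⁵ + X⁷ + … − 3X⁴⁷ + X⁴⁹` (forty nonzero monomials, degree `49`). -/
theorem eval_unit_eleven_lopsided (x : ℝ) :
    (pathDet (fun _ => (1 : ℝ))
        (fun t => if t = 0 then 1 else if t = 2 then 12 else if t = 4 then 1 else if t = 5 then 1 else if t = 6 then 3 else if t = 7 then 6 else if t = 10 then 1 else 0)
        (fun _ => (1 : ℝ))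
        (fun t => if t = 0 then 5 else if t = 2 then 5 else if t = 3 then 1 else if t = 4 then 2 else if t = 7 then 9 else if t = 8 then 3 else if t = 9 then 1 else 0) 11).eval x =
      x ^ 4 - 2 * x ^ 5 + x ^ 7 + x ^ 9 - 3 * x ^ 10 + 2 * x ^ 11 + x ^ 12 - x ^ 13 + 3 * x ^ 14 - 2 * x ^ 15 - 2 * x ^ 16 +
        3 * x ^ 17 + x ^ 19 - 3 * x ^ 20 - 3 * x ^ 21 + 6 * x ^ 22 - 5 * x ^ 23 + x ^ 24 + 4 * x ^ 25 - 8 * x ^ 26 + x ^ 27 + x ^ 28 +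
        3 * x ^ 29 + x ^ 30 - 7 * x ^ 31 + 5 * x ^ 32 + 2 * x ^ 33 - 3 * x ^ 34 + 5 * x ^ 35 - 2 * x ^ 36 - 2 * x ^ 37 + 2 * x ^ 38 +
        2 * x ^ 40 - 2 * x ^ 41 - 2 * x ^ 42 + 2 * x ^ 43 - 2 * x ^ 44 + x ^ 45 + 2 * x ^ 46 - 3 * x ^ 47 + x ^ 49 := by
  obtain ⟨e0, e1⟩ := eval_unit_zero_one
    (fun t => if t = 0 then 1 else if t = 2 then 12 else if t = 4 then 1 else if t = 5 then 1 else if t = 6 then 3 else if t = 7 then 6 else if t = 10 then 1 else 0)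
    (fun t => if t = 0 then 5 else if t = 2 then 5 else if t = 3 then 1 else if t = 4 then 2 else if t = 7 then 9 else if t = 8 then 3 else if t = 9 then 1 else 0) x
  have e := fun n => eval_unit_add_two
    (fun t => if t = 0 then 1 else if t = 2 then 12 else if t = 4 then 1 else if t = 5 then 1 else if t = 6 then 3 else if t = 7 then 6 else if t = 10 then 1 else 0)
    (fun t => if t = 0 then 5 else if t = 2 then 5 else if t = 3 then 1 else if t = 4 then 2 else if t = 7 then 9 else if t = 8 then 3 else if t = 9 then 1 else 0) x n
  have e2 := e 0
  have e3 := e 1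
  have e4 := e 2
  have e5 := e 3
  have e6 := e 4
  have e7 := e 5
  have e8 := e 6
  have e9 := e 7
  have e10 := e 8
  have e11 := e 9
  simp only [zero_add] at e2
  rw [e11, e10, e9, e8, e7, e6, e5, e4, e3, e2, e1, e0]
  norm_num
  ring

/-- **`U 11 ≥ 6`**: the lopsided size-`11` design has at least six distinct positive determinant zeros (signs `+ − + − + − +` at
`1/2, 7/10, 9/10, 49/50, 26/25, 6/5, 3/2`) — one more than every one-signed unit design of size `11` (`⌊11/2⌋ = 5`). [this file] -/
theorem exists_unit_eleven_six_le_card :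
    ∃ d f : ℕ → ℕ, 6 ≤ ((pathDet (fun _ => (1 : ℝ)) d (fun _ => (1 : ℝ)) f 11).roots.toFinset.filter (fun x => 0 < x)).card := by
  refine ⟨(fun t => if t = 0 then 1 else if t = 2 then 12 else if t = 4 then 1 else if t = 5 then 1 else if t = 6 then 3 else if t = 7 then 6 else if t = 10 then 1 else 0),
    (fun t => if t = 0 then 5 else if t = 2 then 5 else if t = 3 then 1 else if t = 4 then 2 else if t = 7 then 9 else if t = 8 then 3 else if t = 9 then 1 else 0),
    le_card_posRoots_of_alternating _ 6 (![1 / 2, 7 / 10, 9 / 10, 49 / 50, 26 / 25, 6 / 5, 3 / 2] : Fin 7 → ℝ) ?_ ?_ ?_⟩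
  · refine Fin.strictMono_iff_lt_succ.2 fun j => ?_
    fin_cases j <;> norm_num [Matrix.cons_val_two, Matrix.tail_cons, Matrix.head_cons]
  · intro j; fin_cases j <;> norm_num [Matrix.cons_val_two, Matrix.tail_cons, Matrix.head_cons]
  · intro j; fin_cases j <;> norm_num [Matrix.cons_val_two, Matrix.tail_cons, Matrix.head_cons, eval_unit_eleven_lopsided]

end StaticTridiagonalRealUnit
end Summit.ValiantsHypothesis.ValiantsHypothesis.Theorems.KPlusLogSqLaw
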